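import Literature.RingTheory.MvPolynomial.NuInvariantInvariance
import Literature.AlgebraicGeometry.Hironaka2017.S04CharAlgebra.R005bEdgeData
import Summits.ResolutionOfSingularities.ResolutionOfSingularities.Theorems.MarkedTransferCampaignW31UscInvOneExponent
import Summits.ResolutionOfSingularities.ResolutionOfSingularities.Theorems.MarkedTransferCampaignW31EdgeConeCoordinates
import HarnessLib

/-!
# [OURS · L1 W3.1] `Inv_ξ(E)` IS WELL DEFINED: `CampaignW31InvWellDefinedI p` holds for every prime `p`
# (kernel proof, unconditional; graded Nakayama via Cossart–Jannsen–Saito standard bases)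

Cell `res-hironaka` (run/shared/lean/pub/res-hironaka/), rung L slot W3.1 «u.s.c. first»; host crux
`Theses.MarkedTransfer.HypersurfaceOrderReduction` (stmt-ResolutionOfSingularities-16155, `--supports … --as helper`,
no new route). Offer res-type-005 2026-08-26T20:35:57Z (a)+(b)+(c); «YES, FILE (a)» res-L1-k31 20:58:15Z; custody
res-L1-dag-5 20:40:53Z. Companion of `MarkedTransferCampaignW31EdgeConeCoordinates.lean` (p472475, the coordinate
change) and of o4's statement file `MarkedTransferCampaignW31UscInvOneExponent.lean` (p463247, the typed OURS `Prop`s).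

HONEST FRAMING. Everything below is OURS-side algebra / pure logic over OUR typed carriers (rows 004/005/007 of the
statements-first typing and the tree's CJS `ν*`-invariant library); NOTHING here is a statement of H. Hironaka's
manuscript *Resolution of singularities in positive characteristics* (2017, [Hironaka2017]) and no candidate statement
of it is used as a premise; no FACT-LIST fact is consumed. What is shown is that the value `Inv_ξ(E)` of Eq. (34) p.24,
AS TYPED (row 007's `inv` read off row 005's edge data with the Def. 4.9 provenance `IsEdgeData`), does not depend on
the choices — the manuscript leaves this implicit (GAP-LEDGER R13); the argument is classical (Hironaka 1964 Ch. III §1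
Lemma 1 as cited by CJS; CJS LNM 2270 Lemma 2.2 / Rem. 2.9 (b)). AI-produced kernel evidence, weaker than expert review.

## The proof (all steps kernel-checked; tree lemmas named)

Let `D`, `D'` be edge data of `℘(E)` at `ξ` with `IsEdgeData` (row 005 part b): r.s.p. `z` (resp. `z'`) of `O_ξ` and a
minimum system of homogeneous generators `ḡ` (resp. `ḡ'`) of the edge ideal `(edgeGPos n ℘(E)_ξ z)` (resp. `… z'`)
with `deg ḡ_j = q_j(D)` (resp. `q_j(D')`).
1. `CampaignW31.isStandardBase_of_isMinHomogGens`: an irredundant homogeneous generating system with non-decreasing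
   degrees is a CJS standard base (tree `Literature.RingTheory.MvPolynomial.IsStandardBase`); the degrees `q_j = p^{e_j}`
   ARE non-decreasing by the carrier field `expo_mono` (Def. 4.11 / Eq. (28)) — `CampaignW31.monotone_q`.
2. `CampaignW31.exists_algEquiv_polyMap_comp` (p472475): a degree-preserving automorphism `θ` of `K[Z]` with
   `polyMap z' ∘ θ = polyMap z`; hence `θ(edgeGPos … z) = edgeGPos … z'` (`image_edgeGPos_eq`), the edge ideals correspond
   (`map_span_edgeGPos_eq`) and their `ν*`-invariants agree (`nuInv_span_edgeGPos_eq`, tree `nuInv_map_algEquiv`,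
   CJS Rem. 2.9 (b)).
3. CJS Lemma 2.2 (tree `IsStandardBase.nuInv_eq` / `nuInv_eq_top`): the degree sequence of a standard base IS `ν*`; so
   `r(D) = r(D')` and `q(D) = q(D')` (`ofFn_eq_of_isStandardBase`), whence `inv D = inv D'` (`inv_eq_of_ofFn_q_eq`).
Main results: `CampaignW31.invWellDefinedAt_edgeDataProvenance` (every scheme, every point, every `p`, `n`, `E`),
**`campaignW31InvWellDefinedI_holds : CampaignW31InvWellDefinedI p`** and
`campaignW31InvWellDefined_holds : CampaignW31InvWellDefined CampaignW31.edgeDataProvenance`.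

Note for the lanes / G3 lead: regularity of `O_ξ` enters only through `IsRSP` (row 004, part of `IsEdgeData`); the
argument uses merely that `z`, `z'` are MINIMAL generating systems of `max(O_ξ)` of length `n = spanFinrank max(O_ξ)`.
Compare `campaignW31InvWellDefinedI_of_dictionary` (res-L1-k31, p467881), which derives the same conclusion from the
hypothesis `CampaignW31EdgeHilbDictionary p`; the present file needs no hypothesis.

## References (context only; nothing below is a premise)

* V. Cossart, U. Jannsen, S. Saito, *Desingularization: Invariants and Strategy*, LNM 2270 (2020), Ch. 2, Def. 2.1,
  Lemma 2.2, Def. 2.3, Rem. 2.9 (b). [CossartJannsenSaito2020]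
* H. Hironaka, Ann. of Math. 79 (1964), Ch. III §1 Lemma 1 (as cited by CJS). [Hironaka1964]
* H. Hironaka, ms. 2017-03-23, Def. 4.9 p.20, Eq. (34) p.24 — scope only, under adjudication. [Hironaka2017]
-/

noncomputable section

set_option linter.dupNamespace false -- mandated namespace of this single-conjunct summit

open IsLocalRing MvPolynomial

namespace Summit.ResolutionOfSingularities.ResolutionOfSingularities.Theorems

open _root_.AlgebraicGeometry
open Literature.AlgebraicGeometry.Resolution
open Literature.AlgebraicGeometry.Hironaka2017
open Literature.AlgebraicGeometry.Hironaka2017.S02Preliminaries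
open Literature.AlgebraicGeometry.Hironaka2017.S04CharAlgebra
open Literature.AlgebraicGeometry.Hironaka2017.Datum
open Literature.RingTheory.MvPolynomial

universe u

namespace CampaignW31

/-! ## Minimal homogeneous generating systems are CJS standard bases -/

section StandardBase

variable {K : Type*} [Field K] {n : ℕ}

/-- [folklore] A minimum system of homogeneous generators of a set `G ⊆ K[Z_1, …, Z_n]` (row 004's `IsMinHomogGens`:
non-zero homogeneous members of `G` generating the ideal `(G)`, irredundant) listed with NON-DECREASING degrees `d` is a
standard base of the ideal `(G)` in the sense of Cossart–Jannsen–Saito (LNM 2270 Def. 2.3; tree `IsStandardBase`):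
irredundancy `g_j ∉ (g_i : i ≠ j)` implies weak normalisation `g_j ∉ (g_l : l < j)`. -/
theorem isStandardBase_of_isMinHomogGens {G : Set (MvPolynomial (Fin n) K)} {r : ℕ}
    {g : Fin r → MvPolynomial (Fin n) K} {d : Fin r → ℕ} (hg : IsMinHomogGens G g)
    (hd : ∀ j, (g j).IsHomogeneous (d j)) (hmono : Monotone d) : IsStandardBase (Ideal.span G) g d where
  isHomogeneous := hd
  span_eq := hg.2.1
  weaklyNormalized := fun j h =>
    hg.2.2 j (Ideal.span_mono (Set.image_mono fun l (hl : l < j) => ne_of_lt hl) h)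
  monotone := hmono

/-- [folklore] **Uniqueness of the degree sequence** (CJS LNM 2270 Lemma 2.2 via the tree's `IsStandardBase.nuInv_eq` /
`nuInv_eq_top`): two standard bases of ideals with the same `ν*`-invariant have the same number of members and the
same degree sequence. -/
theorem ofFn_eq_of_isStandardBase {I I' : Ideal (MvPolynomial (Fin n) K)} {m m' : ℕ}
    {φ : Fin m → MvPolynomial (Fin n) K} {d : Fin m → ℕ} {φ' : Fin m' → MvPolynomial (Fin n) K} {d' : Fin m' → ℕ}
    (h : IsStandardBase I φ d) (h' : IsStandardBase I' φ' d') (hν : ∀ i, nuInv I i = nuInv I' i) :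
    List.ofFn d = List.ofFn d' := by
  have hmm : m = m' := by
    by_contra hne
    rcases Nat.lt_or_gt_of_ne hne with hlt | hlt
    · have h1 : nuInv I m = ⊤ := h.nuInv_eq_top le_rfl
      have h2 : nuInv I' m = d' ⟨m, hlt⟩ := h'.nuInv_eq ⟨m, hlt⟩
      rw [hν, h2] at h1
      exact ENat.coe_ne_top _ h1
    · have h1 : nuInv I' m' = ⊤ := h'.nuInv_eq_top le_rfl
      have h2 : nuInv I m' = d ⟨m', hlt⟩ := h.nuInv_eq ⟨m', hlt⟩
      rw [← hν, h2] at h1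
      exact ENat.coe_ne_top _ h1
  subst hmm
  have hdd : d = d' := by
    funext i
    have e := ((h.nuInv_eq i).symm.trans (hν i)).trans (h'.nuInv_eq i)
    exact_mod_cast e
  rw [hdd]

end StandardBase

/-! ## Transport of the edge ideal along a coordinate change -/

section Transport

variable {O : Type u} [CommRing O] [IsLocalRing O] {n : ℕ} {z z' : Fin n → O}
  (hz : Ideal.span (Set.range z) = maximalIdeal O) (hz' : Ideal.span (Set.range z') = maximalIdeal O)
  {θ : MvPolynomial (Fin n) (ResidueField O) ≃ₐ[ResidueField O] MvPolynomial (Fin n) (ResidueField O)}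
  (hθ : ∀ (d : ℕ) (f : MvPolynomial (Fin n) (ResidueField O)), f.IsHomogeneous d → (θ f).IsHomogeneous d)
  (hθ' : ∀ (d : ℕ) (f : MvPolynomial (Fin n) (ResidueField O)), f.IsHomogeneous d → (θ.symm f).IsHomogeneous d)
  (hcomp : ∀ f, polyMap z' hz' (θ f) = polyMap z hz f) (P : Subalgebra O (Polynomial O))

include hθ hθ' hcomp in
/-- [folklore] A degree-preserving automorphism `θ` intertwining `polyMap z` and `polyMap z'` carries row 005's
generating set `edgeGPos n P z` (positive-degree homogeneous members of `edgeG P z`) ONTO `edgeGPos n P z'`. -/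
theorem image_edgeGPos_eq : θ '' edgeGPos n P z hz = edgeGPos n P z' hz' := by
  ext f'
  constructor
  · rintro ⟨f, ⟨hfG, d, hd1, hfd⟩, rfl⟩
    exact ⟨(mem_edgeG_iff_of_polyMap_comp hz hz' hcomp P f).mp hfG, d, hd1, hθ d f hfd⟩
  · rintro ⟨hf'G, d, hd1, hf'd⟩
    refine ⟨θ.symm f', ⟨?_, d, hd1, hθ' d f' hf'd⟩, θ.apply_symm_apply f'⟩
    rw [mem_edgeG_iff_of_polyMap_comp hz hz' hcomp P, θ.apply_symm_apply]
    exact hf'G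

include hθ hθ' hcomp in
/-- [folklore] Hence the edge ideals correspond: `θ((edgeGPos n P z)) = (edgeGPos n P z')`. -/
theorem map_span_edgeGPos_eq :
    (Ideal.span (edgeGPos n P z hz)).map
        (θ : MvPolynomial (Fin n) (ResidueField O) →+* MvPolynomial (Fin n) (ResidueField O)) =
      Ideal.span (edgeGPos n P z' hz') := by
  rw [Ideal.map_span, ← image_edgeGPos_eq hz hz' hθ hθ' hcomp P]
  rfl

include hθ hθ' hcomp in
/-- [folklore] Hence the `ν*`-invariants of the two edge ideals agree (tree `nuInv_map_algEquiv`, CJS Rem. 2.9 (b)). -/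
theorem nuInv_span_edgeGPos_eq (i : ℕ) :
    nuInv (Ideal.span (edgeGPos n P z hz)) i = nuInv (Ideal.span (edgeGPos n P z' hz')) i := by
  rw [← map_span_edgeGPos_eq hz hz' hθ hθ' hcomp P, nuInv_map_algEquiv θ hθ hθ']

end Transport

/-! ## `Inv_ξ(E)` is well defined -/

section Inv

variable {Z : Scheme.{u}} {p : ℕ} [hp : Fact p.Prime] {n : ℕ} {E : IdealExponent Z} {ξ : Z}

/-- [folklore] The edge exponents `q_j = p^{e_j}` of an edge datum are non-decreasing (row 005's carrier field
`expo_mono`, Def. 4.11 / Eq. (28)). -/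
theorem monotone_q (D : EdgeDatumAt p n E ξ) : Monotone (EdgeDatum.q D) :=
  fun _ _ hij => Nat.pow_le_pow_right hp.out.pos (EdgeDatum.expo_mono D hij)

/-- [folklore] Row 007's value `inv D = (n, n − r, q_1, …, q_r)` depends only on the exponent list `[q_1, …, q_r]`. -/
theorem inv_eq_of_ofFn_q_eq {D D' : EdgeDatumAt p n E ξ}
    (h : List.ofFn (EdgeDatum.q D) = List.ofFn (EdgeDatum.q D')) : inv D = inv D' := by
  have key : ∀ (q q' : List ℕ) (h₁ : q.length ≤ n) (h₂ : ∀ x ∈ q, 1 ≤ x) (h₁' : q'.length ≤ n)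
      (h₂' : ∀ x ∈ q', 1 ≤ x), q = q' → invOfExponents n q h₁ h₂ = invOfExponents n q' h₁' h₂' := by
    intro q q' _ _ _ _ hqq'
    subst hqq'
    rfl
  exact key _ _ _ _ _ _ h

/-- **[OURS · L1 W3.1] `Inv_ξ(E)` IS WELL DEFINED — at every point, on every scheme, unconditionally.** For any two
edge data `D`, `D'` of `℘(E)` at `ξ` carrying the Def. 4.9 provenance AS TYPED (row 005 part b
`S04CharAlgebra.IsEdgeData`: the `g_j` lift a minimum system of homogeneous generators `ḡ_j`, `deg ḡ_j = q_j`, of the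
edge ideal `(edgeGPos n ℘(E)_ξ z)` for some regular system of parameters `z`), row 007's values agree:
`inv D = inv D'`, i.e. `CampaignW31.InvWellDefinedAt p n E edgeDataProvenance ξ`. Proof: a second r.s.p. `z'` changes
the edge ideal by a degree-preserving automorphism of `K[Z]` (`exists_algEquiv_polyMap_comp`), which preserves the
`ν*`-invariant (CJS Rem. 2.9 (b)); a minimum homogeneous generating system with its non-decreasing degrees `q` is a CJS
standard base, whose degree sequence IS `ν*` (CJS Lemma 2.2) — so both `q`-lists coincide. No manuscript candidate and
no FACT-LIST premise is used; replaces the role of the implicit well-definedness of Eq. (34) p.24; NOT a statement of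
the manuscript. [folklore] -/
theorem invWellDefinedAt_edgeDataProvenance (p n : ℕ) [Fact p.Prime] (E : IdealExponent Z) (ξ : Z) :
    InvWellDefinedAt p n E CampaignW31.edgeDataProvenance ξ := by
  intro D D' hD hD'
  obtain ⟨z, hz, gbar, hhom, hmin, -, -⟩ := hD
  obtain ⟨z', hz', gbar', hhom', hmin', -, -⟩ := hD'
  obtain ⟨θ, hθ, hθ', hcomp⟩ := exists_algEquiv_polyMap_comp hz hz'
  have hsb := isStandardBase_of_isMinHomogGens hmin hhom (monotone_q D)
  have hsb' := isStandardBase_of_isMinHomogGens hmin' hhom' (monotone_q D')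
  exact inv_eq_of_ofFn_q_eq (ofFn_eq_of_isStandardBase hsb hsb' (nuInv_span_edgeGPos_eq hz.2.1 hz'.2.1 hθ hθ' hcomp _))

end Inv

end CampaignW31

open CampaignW31

/-- **[OURS · L1 W3.1] `CampaignW31InvWellDefinedI p` HOLDS** (the `p`-slice of o4's typed OURS statement, p463247):
over perfect fields of characteristic `p`, on every ambient datum, for every `n`, every standard ideal exponent `E` and
every closed point `ξ ∈ Sing(E)`, any two Def. 4.9 edge data AS TYPED give the same `Inv_ξ(E)`. Immediate from
`CampaignW31.invWellDefinedAt_edgeDataProvenance`, which needs none of these hypotheses. Replaces the role of the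
implicit well-definedness of Eq. (34) p.24 l.29–31; NOT a statement of the manuscript. [folklore] -/
theorem campaignW31InvWellDefinedI_holds (p : ℕ) [Fact p.Prime] : CampaignW31InvWellDefinedI.{u} p :=
  fun _ _ _ _ _ n E _ ξ _ => invWellDefinedAt_edgeDataProvenance p n E ξ

/-- **[OURS · L1 W3.1] `CampaignW31InvWellDefined CampaignW31.edgeDataProvenance` HOLDS** (the parametric OURS
statement of p463247 instantiated at row 005 part b's provenance, all primes at once). NOT a statement of the
manuscript. [folklore] -/
theorem campaignW31InvWellDefined_holds :
    CampaignW31InvWellDefined.{u} CampaignW31.edgeDataProvenance :=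
  fun p _ _ _ _ _ _ n E _ ξ _ => invWellDefinedAt_edgeDataProvenance p n E ξ

end Summit.ResolutionOfSingularities.ResolutionOfSingularities.Theorems

end
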